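import Summits.QuantumAdvantage.QuantumAdvantage.Theses.SymplecticPurity
import Summits.QuantumAdvantage.QuantumAdvantage.Theses.Shor
import Literature.Computability.Cryptography.ShorAssemblyLeavesProofs

/-!
# `deq_thesis` (`FFThesis := BQP ⊆ BPP`) versus route Shor's thesis: the negative edges

Negative-side support file for the shared crux item `stmt-QuantumAdvantage-0242` (refuter
`cdisprove`). Route Shor's thesis `Shor.ShorThesis := FACT ∉ BPP` (item `stmt-QuantumAdvantage-0231`,
conjecture-grade, positive side) and this crux X (`BQP ⊆ BPP`, the ¬S-side thesis shared by nine
routes) EXCLUDE EACH OTHER, by Shor's theorem `FACT ∈ BQP` — a tree THEOREM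
(`FACT_mem_BQP_holds`, `ShorAssemblyLeavesProofs.lean`). Both implications are typed against the
registered route decls so that the audit indexes them as negative edges between items:

* `deqThesis_false_of_shorThesis : ShorThesis → ¬ FFThesis` (0231 ⇒ ¬0242);
* `shorThesis_false_of_deqThesis : FFThesis → ¬ ShorThesis` (0242 ⇒ ¬0231).

Kept in a file of its own (it imports two route files). The hypothesis-spelled-out form
`FACT ∉ BPP → ¬ FFThesis` is `deqThesis_false_of_FACT_not_mem_BPP` in `DeqThesisKillIsSummit.lean`.
Deliberately a plain negative lemma (no `--negative-modulo` hold): `ShorThesis` is a hardness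
conjecture, not a constructible object.

## References

* P. W. Shor, *Polynomial-time algorithms for prime factorization and discrete logarithms on a
  quantum computer*, SIAM J. Comput. 26 (1997), §5. [Shor1997SICOMP]
-/

set_option linter.dupNamespace false -- D-0017: single-conjunct summit, namespace `Summit.QuantumAdvantage.QuantumAdvantage…` by design

open Literature.Computability.Complexity Literature.Computability.Cryptography
open Literature.Computability.QuantumComplexity

namespace Summit.QuantumAdvantage.QuantumAdvantage.Theorems.DeqThesis.Negative

open Summit.QuantumAdvantage.QuantumAdvantage.Theses.SymplecticPurity (FFThesis)
open Summit.QuantumAdvantage.QuantumAdvantage.Theses.Shor (ShorThesis)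

/-- **Route Shor's thesis refutes the crux**: `ShorThesis → ¬ FFThesis` (`FACT ∉ BPP` and
`BQP ⊆ BPP` are incompatible with the theorem `FACT ∈ BQP`). [cite: Shor1997SICOMP, §5] -/
theorem deqThesis_false_of_shorThesis (h : ShorThesis) : ¬ FFThesis :=
  fun hX => h (hX (show FACT ∈ BQP from FACT_mem_BQP_holds))

/-- **The crux refutes route Shor's thesis**: `FFThesis → ¬ ShorThesis`. [cite: Shor1997SICOMP, §5] -/
theorem shorThesis_false_of_deqThesis (hX : FFThesis) : ¬ ShorThesis :=
  fun h => h (hX (show FACT ∈ BQP from FACT_mem_BQP_holds))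

end Summit.QuantumAdvantage.QuantumAdvantage.Theorems.DeqThesis.Negative
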